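import Literature.NumberTheory.Transcendental.CubeChartBasics
import HarnessLib

/-!
# Dyadic localisation of the unit cube

The `2ⁿ` affine charts `D_c : ℝⁿ → ℝⁿ`, `c : Fin n → Bool`,
`D_c(y)ᵢ = 1 - yᵢ/2` if `cᵢ`, `= yᵢ/2` otherwise, rescale the `2ⁿ` half-cubes of `[0,1]ⁿ` (corner
pattern `c`) to the whole cube. Recorded here, with `K = [0,1]ⁿ` (`Set.pi univ (Icc 0 1)`) and
`O = (0,1)ⁿ` (`Set.pi univ (Ioo 0 1)`):

* `D_c` is analytic, `ℚ`-semialgebraic, injective with `det D(D_c) ≠ 0` (it has the affine inverse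
  `xᵢ ↦ 2(1 - xᵢ)` / `2xᵢ`), maps `K` into `K` and `O` into `O`;
* the images `D_c(O)` are pairwise disjoint and cover `O` off the null hyperplanes `{yᵢ = 1/2}`;
* **far faces become units**: along `D_c` a cube-monomial `∏ xᵢ^{aᵢ}(1 - xᵢ)^{bᵢ}` is the PURE
  monomial `∏ yᵢ^{pᵢ}`, `pᵢ = bᵢ` if `cᵢ` else `aᵢ`, times a polynomial unit which is positive on
  `{y | ∀ i, yᵢ < 2} ⊇ K`.

This is the localisation step preceding the toric (monomial) charts in the cube–Nash normal form of
Kontsevich–Zagier periods; everything is elementary. No definitions (the map is written as a lambda).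

## References

* M. Kontsevich, D. Zagier, *Periods* (2001), §1.2.
* E. Bierstone, P. Milman, *Semianalytic and subanalytic sets*, Publ. IHÉS 67 (1988), §4.
-/

noncomputable section

open Set Filter Topology _root_.MeasureTheory MvPolynomial
open Literature.ModelTheory.ExponentialFields (IsSemialgebraic)

namespace Literature.NumberTheory.Transcendental

variable {n : ℕ}

/-! ### The dyadic charts -/

/-- The dyadic charts are analytic (affine). [folklore] -/
theorem analyticAt_dyadic (c : Fin n → Bool) (x : Fin n → ℝ) :
    AnalyticAt ℝ (fun (y : Fin n → ℝ) (i : Fin n) => if c i then 1 - y i / 2 else y i / 2) x := by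
  refine AnalyticAt.pi fun i => ?_
  have hi := (ContinuousLinearMap.proj (R := ℝ) (φ := fun _ : Fin n => ℝ) i).analyticAt x
  rcases Bool.eq_false_or_eq_true (c i) with h | h <;> simp only [h, Bool.false_eq_true, if_true,
    if_false]
  · exact analyticAt_const.sub hi.div_const
  · exact hi.div_const

/-- The affine inverses of the dyadic charts are analytic. [folklore] -/
theorem analyticAt_dyadicInv (c : Fin n → Bool) (x : Fin n → ℝ) :
    AnalyticAt ℝ (fun (y : Fin n → ℝ) (i : Fin n) => if c i then 2 * (1 - y i) else 2 * y i) x := by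
  refine AnalyticAt.pi fun i => ?_
  have hi := (ContinuousLinearMap.proj (R := ℝ) (φ := fun _ : Fin n => ℝ) i).analyticAt x
  rcases Bool.eq_false_or_eq_true (c i) with h | h <;> simp only [h, Bool.false_eq_true, if_true,
    if_false]
  · exact analyticAt_const.mul (analyticAt_const.sub hi)
  · exact analyticAt_const.mul hi

/-- `xᵢ ↦ 2(1 - xᵢ)` / `2xᵢ` is a left inverse of the dyadic chart `D_c`. [folklore] -/
theorem dyadicInv_dyadic (c : Fin n → Bool) (y : Fin n → ℝ) :
    (fun (x : Fin n → ℝ) (i : Fin n) => if c i then 2 * (1 - x i) else 2 * x i)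
      ((fun (y : Fin n → ℝ) (i : Fin n) => if c i then 1 - y i / 2 else y i / 2) y) = y := by
  funext i
  rcases Bool.eq_false_or_eq_true (c i) with h | h <;> simp only [h, Bool.false_eq_true, if_true,
    if_false] <;> ring

/-- The dyadic charts are injective. [folklore] -/
theorem injective_dyadicChart (c : Fin n → Bool) :
    Function.Injective (fun (y : Fin n → ℝ) (i : Fin n) => if c i then 1 - y i / 2 else y i / 2) :=
  Function.LeftInverse.injective
    (g := fun (x : Fin n → ℝ) (i : Fin n) => if c i then 2 * (1 - x i) else 2 * x i)
    (dyadicInv_dyadic c)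

/-- The dyadic charts have non-vanishing Jacobian determinant (`= ±2⁻ⁿ`). [folklore] -/
theorem det_fderiv_dyadic_ne_zero (c : Fin n → Bool) (x : Fin n → ℝ) :
    (fderiv ℝ (fun (y : Fin n → ℝ) (i : Fin n) => if c i then 1 - y i / 2 else y i / 2) x).det ≠ 0 :=
  det_fderiv_ne_zero_of_leftInverse (analyticAt_dyadic c x).differentiableAt
    (analyticAt_dyadicInv c _).differentiableAt (Eventually.of_forall (dyadicInv_dyadic c))

/-- The dyadic charts are `ℚ`-semialgebraic (polynomial maps). [folklore] -/
theorem isSemialgebraicMapOn_dyadic (c : Fin n → Bool) {s : Set (Fin n → ℝ)}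
    (hs : IsSemialgebraic ℚ s) :
    IsSemialgebraicMapOn ℚ s
      (fun (y : Fin n → ℝ) (i : Fin n) => if c i then 1 - y i / 2 else y i / 2) := by
  refine (isSemialgebraicMapOn_aeval hs fun i =>
    if c i then 1 - X i * C (1 / 2 : ℚ) else X i * C (1 / 2 : ℚ)).congr fun y _ => ?_
  funext i
  rcases Bool.eq_false_or_eq_true (c i) with h | h <;> simp [h, div_eq_mul_inv]

/-- `D_c` maps the closed cube into itself. [folklore] -/
theorem dyadic_mapsTo_pi_Icc (c : Fin n → Bool) :
    MapsTo (fun (y : Fin n → ℝ) (i : Fin n) => if c i then 1 - y i / 2 else y i / 2)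
      (Set.pi Set.univ fun _ : Fin n => Set.Icc (0 : ℝ) 1)
      (Set.pi Set.univ fun _ : Fin n => Set.Icc (0 : ℝ) 1) := by
  intro y hy
  simp only [Set.mem_univ_pi, Set.mem_Icc] at hy ⊢
  intro i
  obtain ⟨h0, h1⟩ := hy i
  rcases Bool.eq_false_or_eq_true (c i) with h | h <;> simp only [h, Bool.false_eq_true, if_true,
    if_false] <;> constructor <;> linarith

/-- `D_c` maps the open cube into itself. [folklore] -/
theorem dyadic_mapsTo_pi_Ioo (c : Fin n → Bool) :
    MapsTo (fun (y : Fin n → ℝ) (i : Fin n) => if c i then 1 - y i / 2 else y i / 2)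
      (Set.pi Set.univ fun _ : Fin n => Set.Ioo (0 : ℝ) 1)
      (Set.pi Set.univ fun _ : Fin n => Set.Ioo (0 : ℝ) 1) := by
  intro y hy
  simp only [Set.mem_univ_pi, Set.mem_Ioo] at hy ⊢
  intro i
  obtain ⟨h0, h1⟩ := hy i
  rcases Bool.eq_false_or_eq_true (c i) with h | h <;> simp only [h, Bool.false_eq_true, if_true,
    if_false] <;> constructor <;> linarith

/-- The open-cube images of two distinct dyadic charts are disjoint (they differ in the `i`-th
coordinate half for any `i` with `cᵢ ≠ c'ᵢ`). [folklore] -/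
theorem pairwise_disjoint_image_dyadic :
    Pairwise fun c c' : Fin n → Bool =>
      Disjoint ((fun (y : Fin n → ℝ) (i : Fin n) => if c i then 1 - y i / 2 else y i / 2) ''
          Set.pi Set.univ fun _ : Fin n => Set.Ioo (0 : ℝ) 1)
        ((fun (y : Fin n → ℝ) (i : Fin n) => if c' i then 1 - y i / 2 else y i / 2) ''
          Set.pi Set.univ fun _ : Fin n => Set.Ioo (0 : ℝ) 1) := by
  intro c c' hne
  obtain ⟨i, hi⟩ := Function.ne_iff.1 hne
  refine Set.disjoint_left.2 ?_
  rintro _ ⟨y, hy, rfl⟩ ⟨y', hy', h⟩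
  have h := congr_fun h i
  simp only [Set.mem_univ_pi, Set.mem_Ioo] at hy hy'
  obtain ⟨h0, h1⟩ := hy i
  obtain ⟨h0', h1'⟩ := hy' i
  rcases Bool.eq_false_or_eq_true (c i) with hc | hc <;>
    rcases Bool.eq_false_or_eq_true (c' i) with hc' | hc' <;>
      simp only [hc, hc', Bool.false_eq_true, if_true, if_false, ne_eq, not_true_eq_false,
        Bool.true_eq_false] at hi h <;> linarith

/-- The dyadic charts cover the open cube off the null hyperplanes `{yᵢ = 1/2}`: the remainder is
Lebesgue-null. [folklore] -/
theorem volume_pi_Ioo_diff_iUnion_image_dyadic :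
    volume ((Set.pi Set.univ fun _ : Fin n => Set.Ioo (0 : ℝ) 1) \
      ⋃ c : Fin n → Bool, (fun (y : Fin n → ℝ) (i : Fin n) => if c i then 1 - y i / 2 else y i / 2) ''
        Set.pi Set.univ fun _ : Fin n => Set.Ioo (0 : ℝ) 1) = 0 := by
  have hsub : (Set.pi Set.univ fun _ : Fin n => Set.Ioo (0 : ℝ) 1) \
      ⋃ c : Fin n → Bool, (fun (y : Fin n → ℝ) (i : Fin n) => if c i then 1 - y i / 2 else y i / 2) ''
        Set.pi Set.univ (fun _ : Fin n => Set.Ioo (0 : ℝ) 1) ⊆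
      ⋃ i : Fin n, {y : Fin n → ℝ | y i = 1 / 2} := by
    rintro y ⟨hy, hy'⟩
    by_contra hcon
    simp only [Set.mem_iUnion, Set.mem_setOf_eq, not_exists] at hcon
    simp only [Set.mem_univ_pi, Set.mem_Ioo] at hy
    apply hy'
    refine Set.mem_iUnion.2 ⟨fun i => decide (1 / 2 < y i),
      fun i => if 1 / 2 < y i then 2 * (1 - y i) else 2 * y i, ?_, ?_⟩
    · simp only [Set.mem_univ_pi, Set.mem_Ioo]
      intro i
      obtain ⟨h0, h1⟩ := hy i
      by_cases hlt : 1 / 2 < y i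
      · rw [if_pos hlt]
        constructor <;> linarith
      · have hlt' : y i < 1 / 2 := lt_of_le_of_ne (not_lt.1 hlt) (hcon i)
        rw [if_neg hlt]
        constructor <;> linarith
    · funext i
      by_cases hlt : 1 / 2 < y i
      · simp only [hlt, decide_true, if_true]
        ring
      · simp only [hlt, decide_false, Bool.false_eq_true, if_false]
        ring
  refine measure_mono_null hsub (measure_iUnion_null fun i => ?_)
  rw [MeasureTheory.volume_pi]
  exact MeasureTheory.Measure.pi_hyperplane _ i _

/-! ### Far faces become units -/

/-- **Cube-monomials pull back to monomials times units along a dyadic chart.** If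
`xᵢ = 1 - yᵢ/2` (`cᵢ`) resp. `yᵢ/2` (`¬cᵢ`) then
`∏ xᵢ^{aᵢ}(1 - xᵢ)^{bᵢ} = (∏ yᵢ^{pᵢ}) · W(y)`, `pᵢ = bᵢ` if `cᵢ` else `aᵢ`,
`W(y) = ∏ᵢ [cᵢ ? 2^{-bᵢ}(1 - yᵢ/2)^{aᵢ} : 2^{-aᵢ}(1 - yᵢ/2)^{bᵢ}]`. [folklore] -/
theorem cubeMonomial_dyadic (c : Fin n → Bool) (a b : Fin n → ℕ) {x y : Fin n → ℝ}
    (hx : ∀ i, x i = if c i then 1 - y i / 2 else y i / 2) :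
    (∏ i, x i ^ a i * (1 - x i) ^ b i) =
      (∏ i, y i ^ (fun i => if c i then b i else a i) i) *
        ∏ i, (if c i then (1 / 2 : ℝ) ^ b i * (1 - y i / 2) ^ a i
          else (1 / 2 : ℝ) ^ a i * (1 - y i / 2) ^ b i) := by
  rw [← Finset.prod_mul_distrib]
  refine Finset.prod_congr rfl fun i _ => ?_
  rw [hx i]
  rcases Bool.eq_false_or_eq_true (c i) with h | h <;>
    simp only [h, Bool.false_eq_true, if_true, if_false] <;> ring

/-- The dyadic unit `W` is analytic. [folklore] -/
theorem analyticAt_dyadicUnit (c : Fin n → Bool) (a b : Fin n → ℕ) (x : Fin n → ℝ) :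
    AnalyticAt ℝ (fun y : Fin n → ℝ => ∏ i, (if c i then (1 / 2 : ℝ) ^ b i * (1 - y i / 2) ^ a i
      else (1 / 2 : ℝ) ^ a i * (1 - y i / 2) ^ b i)) x := by
  refine Finset.univ.analyticAt_fun_prod fun i _ => ?_
  have hi := (ContinuousLinearMap.proj (R := ℝ) (φ := fun _ : Fin n => ℝ) i).analyticAt x
  rcases Bool.eq_false_or_eq_true (c i) with h | h <;>
    simp only [h, Bool.false_eq_true, if_true, if_false]
  · exact analyticAt_const.mul ((analyticAt_const.sub hi.div_const).pow _)
  · exact analyticAt_const.mul ((analyticAt_const.sub hi.div_const).pow _)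

/-- The dyadic unit `W` is positive on `{y | ∀ i, yᵢ < 2}`. [folklore] -/
theorem dyadicUnit_pos (c : Fin n → Bool) (a b : Fin n → ℕ) {y : Fin n → ℝ} (hy : ∀ i, y i < 2) :
    0 < ∏ i, (if c i then (1 / 2 : ℝ) ^ b i * (1 - y i / 2) ^ a i
      else (1 / 2 : ℝ) ^ a i * (1 - y i / 2) ^ b i) := by
  refine Finset.prod_pos fun i _ => ?_
  have h2 : 0 < 1 - y i / 2 := by linarith [hy i]
  rcases Bool.eq_false_or_eq_true (c i) with h | h <;>
    simp only [h, Bool.false_eq_true, if_true, if_false] <;> positivity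

/-- The dyadic unit `W` is positive near the closed cube (an `𝓝ˢ`-germ statement). [folklore] -/
theorem eventually_nhdsSet_dyadicUnit (c : Fin n → Bool) (a b : Fin n → ℕ) :
    ∀ᶠ y in 𝓝ˢ (Set.pi Set.univ fun _ : Fin n => Set.Icc (0 : ℝ) 1),
      AnalyticAt ℝ (fun y : Fin n → ℝ => ∏ i, (if c i then (1 / 2 : ℝ) ^ b i * (1 - y i / 2) ^ a i
        else (1 / 2 : ℝ) ^ a i * (1 - y i / 2) ^ b i)) y ∧
      0 < ∏ i, (if c i then (1 / 2 : ℝ) ^ b i * (1 - y i / 2) ^ a i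
        else (1 / 2 : ℝ) ^ a i * (1 - y i / 2) ^ b i) := by
  have hopen : IsOpen {y : Fin n → ℝ | ∀ i, y i < 2} := by
    rw [show {y : Fin n → ℝ | ∀ i, y i < 2} = ⋂ i, {y | y i < 2} by ext; simp]
    exact isOpen_iInter_of_finite fun i => isOpen_lt (continuous_apply i) continuous_const
  have hmem : {y : Fin n → ℝ | ∀ i, y i < 2} ∈
      𝓝ˢ (Set.pi Set.univ fun _ : Fin n => Set.Icc (0 : ℝ) 1) :=
    hopen.mem_nhdsSet.2 fun y hy i => ((Set.mem_univ_pi.1 hy) i).2.trans_lt one_lt_two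
  filter_upwards [hmem] with y hy
  exact ⟨analyticAt_dyadicUnit c a b y, dyadicUnit_pos c a b hy⟩

end Literature.NumberTheory.Transcendental
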